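import Summits.AtomisticToContinuum.Crystallization.Theses.PricedLinkCensus
import Summits.AtomisticToContinuum.Crystallization.Theorems.PricedLinkCensusTruncatedCensusGapPeriodicStability
import Summits.AtomisticToContinuum.Crystallization.Theorems.PricedLinkCensusTruncatedCensusGapBarlowWindowLink
import Summits.AtomisticToContinuum.Crystallization.Theorems.PricedLinkCensusTruncatedCensusGapChargeFreeOpenAtGerm
import Summits.AtomisticToContinuum.Crystallization.Theorems.PricedLinkCensusTruncatedCensusGapKnabeCompactness

/-!
# `TruncatedCensusGap` reduces to the metric defect gap (and to any dominated local energy inequality)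

Helper file for the crux `PricedLinkCensus.TruncatedCensusGap` (item stmt-AtomisticToContinuum-14230),
line `frustration-free-census-germ`, reshape r3 of its skeleton
(`Cruxes/TruncatedCensusGap/Lines/frustration_free_census_germ.lean`).  It records in importable form
what the four landed stubs of the line (p84999 periodic stability, p85249 window link, p85261 open
margin, p85371 Knabe compactness) buy:

* `isChargeFree_of_germMatched_barlow` — the open margin at the EXPLICIT precision `1/1000`: a site
  whose `3a`-neighbourhood is `a/2`-separated and two-way `(a/1000)`-matched to a rigid image of a
  Barlow stacking `barlowStacking a c s` (`s` Hägg, spacing window `|c − a√(2/3)| ≤ a√(2/3)/250`) is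
  charge-free at tolerance `1/100`;
* `truncatedCensusGap_of_metricDefectGap` — hence the crux follows from the METRIC DEFECT GAP
  `∃ κ > 0, ∀ N y injective, N · e_χ* + κ · #{i not (1/1000)-germ-matched} ≤ E_χ(y)` (the one
  registered open stub `stub_metricDefectGap` of the line after r3);
* `truncatedCensusGap_of_localEnergyInequality` — and from any `R`-local, isometry-invariant,
  non-negative, lower semicontinuous site functional with a crowding floor and a perfect-germ zero set
  whose sum is dominated by `E_χ(y) − N · e_χ(Q₀)` for some periodic `Q₀` (the idea's star forms are
  the exact case), through the landed Knabe compactness.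

All statements are spelled out over tree declarations (no local definitions), so that the hypotheses
can be discharged verbatim by a later file.
-/

noncomputable section

namespace Summit.AtomisticToContinuum.Crystallization.Theorems.PricedLinkCensusTruncatedCensusGap

open scoped BigOperators
open Literature.MathematicalPhysics.StatisticalMechanics Literature.Geometry.DiscreteGeometry

/-- **The open margin at precision `1/1000`.**  A site whose `3a`-neighbourhood is `a/2`-separated
and two-way `(a/1000)`-matched to a rigid image of a Barlow stacking with layer spacing in the window
`±1/250` is charge-free at tolerance `1/100` (the constant inside the landed `stub_chargeFreeOpenAtGerm`,
made explicit; from `germ_window_bounds`, `isChargeFree_of_germMatched` and the landed window link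
`stub_barlowWindowLink`). [folklore] -/
theorem isChargeFree_of_germMatched_barlow {N : ℕ} {y : Fin N → EuclideanSpace ℝ (Fin 3)} {i : Fin N}
    (hgm : ∃ (a c : ℝ) (s : ℤ → ℤ)
        (g : EuclideanSpace ℝ (Fin 3) ≃ᵃⁱ[ℝ] EuclideanSpace ℝ (Fin 3)),
      0 < a ∧ IsHaggSeq s ∧ |c - a * Real.sqrt (2 / 3)| ≤ a * Real.sqrt (2 / 3) / 250 ∧
      (∀ j k : Fin N, j ≠ k → dist (y j) (y i) ≤ 3 * a → a / 2 ≤ dist (y j) (y k)) ∧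
      (∀ j : Fin N, dist (y j) (y i) ≤ 3 * a →
          ∃ z ∈ barlowStacking a c s, dist (y j) (g z) ≤ 1 / 1000 * a) ∧
      (∀ z ∈ barlowStacking a c s, dist (g z) (y i) ≤ 3 * a →
          ∃ j : Fin N, dist (y j) (g z) ≤ 1 / 1000 * a)) :
    IsChargeFree (1 / 100 : ℝ) y i := by
  obtain ⟨a, c, s, g, ha, hs, hc, hsep, hM1, hM2⟩ := hgm
  obtain ⟨hc1, hc2, hl1, hl2⟩ := germ_window_bounds ha hc
  have hW' := stub_barlowWindowLink a c s ha hc1 hc2 hs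
  rw [← isChargeFree_comp_isometry_iff g.symm.isometry (1 / 100 : ℝ) y i]
  have hdyy : ∀ j k, dist ((⇑g.symm ∘ y) j) ((⇑g.symm ∘ y) k) = dist (y j) (y k) := fun j k =>
    g.symm.dist_map (y j) (y k)
  have hdyz : ∀ j z, dist ((⇑g.symm ∘ y) j) z = dist (y j) (g z) := fun j z => by
    rw [Function.comp_apply, ← g.symm.dist_map (y j) (g z), g.symm_apply_apply]
  refine isChargeFree_of_germMatched (T := barlowStacking a c s) ha ?_ ?_
    (fun z₀ hz₀ => (hW' z₀ hz₀).2.1) (fun z₀ hz₀ => (hW' z₀ hz₀).2.2) ?_ ?_ ?_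
  · intro z hz w hw hne
    have h1 := le_dist_of_mem_barlowStacking a c s ha.le (by linarith) hz hw hne
    have h2 : 81 / 100 * a ≤ min a c := le_min (by linarith) hc1
    linarith
  · intro z₀ hz₀ z hz hne hd
    rcases (hW' z₀ hz₀).1 z hz hne hd with h | h <;> rw [h]
    · constructor <;> linarith
    · exact ⟨hl1, hl2⟩
  · intro j k hjk hj
    rw [hdyy] at hj ⊢
    exact hsep j k hjk hj
  · intro j hj
    rw [hdyy] at hj
    obtain ⟨z, hz, hd⟩ := hM1 j hj
    exact ⟨z, hz, by rw [hdyz]; exact hd⟩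
  · intro z hz hd
    rw [dist_comm, hdyz, dist_comm] at hd
    obtain ⟨j, hj⟩ := hM2 z hz hd
    exact ⟨j, by rw [hdyz]; exact hj⟩

/-- **Counting.**  Every charged site is a metric defect at precision `1/1000`, so a configuration has
no more charged sites than sites that are not `(1/1000)`-germ-matched. [folklore] -/
theorem card_charged_le_card_not_germMatched {N : ℕ} (y : Fin N → EuclideanSpace ℝ (Fin 3)) :
    Nat.card {i : Fin N // ¬ IsChargeFree (1 / 100 : ℝ) y i} ≤
      Nat.card {i : Fin N //
        ¬ ∃ (a c : ℝ) (s : ℤ → ℤ)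
            (g : EuclideanSpace ℝ (Fin 3) ≃ᵃⁱ[ℝ] EuclideanSpace ℝ (Fin 3)),
          0 < a ∧ IsHaggSeq s ∧ |c - a * Real.sqrt (2 / 3)| ≤ a * Real.sqrt (2 / 3) / 250 ∧
          (∀ j k : Fin N, j ≠ k → dist (y j) (y i) ≤ 3 * a → a / 2 ≤ dist (y j) (y k)) ∧
          (∀ j : Fin N, dist (y j) (y i) ≤ 3 * a →
              ∃ z ∈ barlowStacking a c s, dist (y j) (g z) ≤ 1 / 1000 * a) ∧
          (∀ z ∈ barlowStacking a c s, dist (g z) (y i) ≤ 3 * a →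
              ∃ j : Fin N, dist (y j) (g z) ≤ 1 / 1000 * a)} := by
  classical
  rw [Nat.card_eq_fintype_card, Nat.card_eq_fintype_card, Fintype.card_subtype,
    Fintype.card_subtype]
  exact Finset.card_le_card (Finset.monotone_filter_right _ fun i _ hi hgm =>
    hi (isChargeFree_of_germMatched_barlow hgm))

/-- **`TruncatedCensusGap` from the metric defect gap.**  If some `κ > 0` prices, above `N · e_χ*`,
every site that is not `(1/1000)`-germ-matched (two-way `(a/1000)`-matching within `3a` to a rigid
Barlow germ, `a/2`-separation, spacing window `±1/250`), then the same `κ` prices every charged site: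
the crux `PricedLinkCensus.TruncatedCensusGap` holds.  (The hypothesis is the registered stub
`stub_metricDefectGap` of line `frustration-free-census-germ`, r3.) [folklore] -/
theorem truncatedCensusGap_of_metricDefectGap :
    (∃ κ : ℝ, 0 < κ ∧
      ∀ (N : ℕ) (y : Fin N → EuclideanSpace ℝ (Fin 3)), Function.Injective y →
        (N : ℝ) * (⨅ Q : PeriodicConfiguration 3,
            Q.energyPerParticle fun r => min 1 (max 0 (4 - 2 * r)) * lennardJones r)
          + κ * (Nat.card {i : Fin N //
              ¬ ∃ (a c : ℝ) (s : ℤ → ℤ)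
                  (g : EuclideanSpace ℝ (Fin 3) ≃ᵃⁱ[ℝ] EuclideanSpace ℝ (Fin 3)),
                0 < a ∧ IsHaggSeq s ∧
                |c - a * Real.sqrt (2 / 3)| ≤ a * Real.sqrt (2 / 3) / 250 ∧
                (∀ j k : Fin N, j ≠ k → dist (y j) (y i) ≤ 3 * a → a / 2 ≤ dist (y j) (y k)) ∧
                (∀ j : Fin N, dist (y j) (y i) ≤ 3 * a →
                    ∃ z ∈ barlowStacking a c s, dist (y j) (g z) ≤ 1 / 1000 * a) ∧
                (∀ z ∈ barlowStacking a c s, dist (g z) (y i) ≤ 3 * a →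
                    ∃ j : Fin N, dist (y j) (g z) ≤ 1 / 1000 * a)} : ℝ)
          ≤ interactionEnergy (fun r => min 1 (max 0 (4 - 2 * r)) * lennardJones r) y) →
    Summit.AtomisticToContinuum.Crystallization.Theses.PricedLinkCensus.TruncatedCensusGap := by
  rintro ⟨κ, hκ, hgap⟩
  refine ⟨κ, hκ, fun N y hy => ?_⟩
  have h1 := hgap N y hy
  have h2 := mul_le_mul_of_nonneg_left
    ((Nat.cast_le (α := ℝ)).mpr (card_charged_le_card_not_germMatched y)) hκ.le
  linarith

/-- **Bookkeeping.**  A non-negative function on the sites that is `≥ κ` wherever a predicate `P`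
fails sums to at least `κ · #{i | ¬ P i}`. [folklore] -/
theorem mul_card_not_le_sum {N : ℕ} (P : Fin N → Prop) (f : Fin N → ℝ) (κ : ℝ)
    (hnn : ∀ i, 0 ≤ f i) (hP : ∀ i, ¬ P i → κ ≤ f i) :
    κ * (Nat.card {i : Fin N // ¬ P i} : ℝ) ≤ ∑ i, f i := by
  classical
  have hcard : Nat.card {i : Fin N // ¬ P i} = (Finset.univ.filter fun i : Fin N => ¬ P i).card := by
    rw [Nat.card_eq_fintype_card, Fintype.card_subtype]
  have h1 : ((Finset.univ.filter fun i : Fin N => ¬ P i).card : ℝ) * κ ≤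
      ∑ i ∈ Finset.univ.filter (fun i : Fin N => ¬ P i), f i := by
    have := Finset.card_nsmul_le_sum (Finset.univ.filter fun i : Fin N => ¬ P i) f κ
      (fun i hi => hP i (Finset.mem_filter.1 hi).2)
    simpa [nsmul_eq_mul] using this
  have h2 : ∑ i ∈ Finset.univ.filter (fun i : Fin N => ¬ P i), f i ≤ ∑ i, f i :=
    Finset.sum_le_univ_sum_of_nonneg hnn
  rw [hcard]
  nlinarith [h1, h2, mul_comm κ ((Finset.univ.filter fun i : Fin N => ¬ P i).card : ℝ)]

/-- **`TruncatedCensusGap` from any dominated local energy inequality.**  If a site functional `h` is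
`R`-local, isometry-invariant, non-negative and lower semicontinuous at injective configurations, has a
crowding floor `(R, r₀, h₀)` and a perfect-germ zero set of radius `4a ≤ R`, and if its SUM over the
sites of every finite injective configuration is at most `E_χ(y) − N · e_χ(Q₀)` for one fixed periodic
configuration `Q₀`, then the crux holds: the landed Knabe compactness (p85371) makes `h ≥ κ(1/1000) > 0`
at every site that is not `(1/1000)`-germ-matched, `e_χ* ≤ e_χ(Q₀)` by the landed periodic stability
(p84999), and `truncatedCensusGap_of_metricDefectGap` finishes.  The idea's frustration-free star forms
(exact reapportionings) are the case of equality in the domination hypothesis. [folklore] -/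
theorem truncatedCensusGap_of_localEnergyInequality :
    (∃ (h : (N : ℕ) → (Fin N → EuclideanSpace ℝ (Fin 3)) → Fin N → ℝ)
        (Q₀ : PeriodicConfiguration 3) (R r₀ h₀ : ℝ),
      0 < r₀ ∧ 0 < h₀ ∧
      (∀ (N M : ℕ) (y : Fin N → EuclideanSpace ℝ (Fin 3)) (f : Fin M ↪ Fin N) (i : Fin M),
        (∀ j : Fin N, dist (y j) (y (f i)) ≤ R → j ∈ Set.range f) →
        h M (y ∘ f) i = h N y (f i)) ∧
      (∀ (N : ℕ) (y : Fin N → EuclideanSpace ℝ (Fin 3)) (i : Fin N)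
        (g : EuclideanSpace ℝ (Fin 3) ≃ᵢ EuclideanSpace ℝ (Fin 3)), h N (g ∘ y) i = h N y i) ∧
      (∀ (N : ℕ) (y : Fin N → EuclideanSpace ℝ (Fin 3)) (i : Fin N), Function.Injective y →
        0 ≤ h N y i) ∧
      (∀ (N : ℕ) (y : Fin N → EuclideanSpace ℝ (Fin 3)) (i : Fin N), Function.Injective y →
        LowerSemicontinuousAt (fun y' : Fin N → EuclideanSpace ℝ (Fin 3) => h N y' i) y) ∧
      (∀ (N : ℕ) (y : Fin N → EuclideanSpace ℝ (Fin 3)) (i : Fin N), Function.Injective y →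
        (∃ j k : Fin N, j ≠ k ∧ dist (y j) (y i) ≤ R ∧ dist (y k) (y i) ≤ R ∧
            dist (y j) (y k) < r₀) →
        h₀ ≤ h N y i) ∧
      (∀ (N : ℕ) (y : Fin N → EuclideanSpace ℝ (Fin 3)) (i : Fin N), Function.Injective y →
        h N y i = 0 →
        ∃ (a c : ℝ) (s : ℤ → ℤ)
            (g : EuclideanSpace ℝ (Fin 3) ≃ᵃⁱ[ℝ] EuclideanSpace ℝ (Fin 3)),
          0 < a ∧ 4 * a ≤ R ∧ IsHaggSeq s ∧
          |c - a * Real.sqrt (2 / 3)| ≤ a * Real.sqrt (2 / 3) / 250 ∧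
          (∀ j : Fin N, dist (y j) (y i) ≤ 4 * a → ∃ z ∈ barlowStacking a c s, y j = g z) ∧
          (∀ z ∈ barlowStacking a c s, dist (g z) (y i) ≤ 4 * a → ∃ j : Fin N, y j = g z)) ∧
      (∀ (N : ℕ) (y : Fin N → EuclideanSpace ℝ (Fin 3)), Function.Injective y →
        ∑ i, h N y i ≤
          interactionEnergy (fun r => min 1 (max 0 (4 - 2 * r)) * lennardJones r) y
            - (N : ℝ) * Q₀.energyPerParticle
                (fun r => min 1 (max 0 (4 - 2 * r)) * lennardJones r))) →
    Summit.AtomisticToContinuum.Crystallization.Theses.PricedLinkCensus.TruncatedCensusGap := by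
  rintro ⟨h, Q₀, R, r₀, h₀, hr₀, hh₀, hloc, hiso, hnn, hlsc, hfloor, hzero, hdom⟩
  obtain ⟨κ, hκ, hgap⟩ := stub_knabeCompactness h R r₀ h₀ hr₀ hh₀ hloc hiso hnn hlsc hfloor hzero
    (1 / 1000) (by norm_num) (by norm_num)
  refine truncatedCensusGap_of_metricDefectGap ⟨κ, hκ, fun N y hy => ?_⟩
  have hle : (⨅ Q : PeriodicConfiguration 3,
      Q.energyPerParticle fun r => min 1 (max 0 (4 - 2 * r)) * lennardJones r) ≤
      Q₀.energyPerParticle fun r => min 1 (max 0 (4 - 2 * r)) * lennardJones r :=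
    ciInf_le stub_periodicStability Q₀
  have hle' := mul_le_mul_of_nonneg_left hle (Nat.cast_nonneg N)
  have hprice := mul_card_not_le_sum
    (fun i : Fin N => ∃ (a c : ℝ) (s : ℤ → ℤ)
        (g : EuclideanSpace ℝ (Fin 3) ≃ᵃⁱ[ℝ] EuclideanSpace ℝ (Fin 3)),
      0 < a ∧ IsHaggSeq s ∧
      |c - a * Real.sqrt (2 / 3)| ≤ a * Real.sqrt (2 / 3) / 250 ∧
      (∀ j k : Fin N, j ≠ k → dist (y j) (y i) ≤ 3 * a → a / 2 ≤ dist (y j) (y k)) ∧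
      (∀ j : Fin N, dist (y j) (y i) ≤ 3 * a →
          ∃ z ∈ barlowStacking a c s, dist (y j) (g z) ≤ 1 / 1000 * a) ∧
      (∀ z ∈ barlowStacking a c s, dist (g z) (y i) ≤ 3 * a →
          ∃ j : Fin N, dist (y j) (g z) ≤ 1 / 1000 * a))
    (fun i => h N y i) κ (fun i => hnn N y i hy) (fun i hi => hgap N y i hy hi)
  have hd := hdom N y hy
  linarith


/-- **NEAR/FAR split of the metric defect gap (glue, proved).**  Fix a coarse precision `ρ`.  Suppose
(NEAR — elastic coercivity with a coarse-defect allowance, relative to ONE periodic configuration `Q₀`):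
`N · e_χ(Q₀) + κ · #{i not (1/1000)-germ-matched} − C · #{i not ρ-germ-matched} ≤ E_χ(y)`, and
(FAR — the coarse metric defect gap relative to `e_χ*`): `N · e_χ* + κ′ · #{i not ρ-germ-matched} ≤ E_χ(y)`,
both for every finite injective `y`.  Then the crux `TruncatedCensusGap` holds, with price
`κκ′/(κ′ + C)`: `e_χ* ≤ e_χ(Q₀)` (landed periodic stability, `ciInf_le`), so NEAR gives
`κ·#fine ≤ (E − N e_χ*) + C·#coarse`, FAR bounds `#coarse`, and `truncatedCensusGap_of_metricDefectGap`
finishes.  (NEAR is the perturbative statement — null-Lagrangian boundary terms at coarse defects are why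
the allowance `C` is needed; FAR is the residual open content at precision `ρ`.) [folklore] -/
theorem truncatedCensusGap_of_near_far :
    ∀ ρ : ℝ,
    (∃ (Q₀ : PeriodicConfiguration 3) (κ C : ℝ), 0 < κ ∧ 0 ≤ C ∧
      ∀ (N : ℕ) (y : Fin N → EuclideanSpace ℝ (Fin 3)), Function.Injective y →
        (N : ℝ) * Q₀.energyPerParticle (fun r => min 1 (max 0 (4 - 2 * r)) * lennardJones r)
          + κ * (Nat.card {i : Fin N //
              ¬ ∃ (a c : ℝ) (s : ℤ → ℤ)
                  (g : EuclideanSpace ℝ (Fin 3) ≃ᵃⁱ[ℝ] EuclideanSpace ℝ (Fin 3)),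
                0 < a ∧ IsHaggSeq s ∧
                |c - a * Real.sqrt (2 / 3)| ≤ a * Real.sqrt (2 / 3) / 250 ∧
                (∀ j k : Fin N, j ≠ k → dist (y j) (y i) ≤ 3 * a → a / 2 ≤ dist (y j) (y k)) ∧
                (∀ j : Fin N, dist (y j) (y i) ≤ 3 * a →
                    ∃ z ∈ barlowStacking a c s, dist (y j) (g z) ≤ 1 / 1000 * a) ∧
                (∀ z ∈ barlowStacking a c s, dist (g z) (y i) ≤ 3 * a →
                    ∃ j : Fin N, dist (y j) (g z) ≤ 1 / 1000 * a)} : ℝ)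
          - C * (Nat.card {i : Fin N //
              ¬ ∃ (a c : ℝ) (s : ℤ → ℤ)
                  (g : EuclideanSpace ℝ (Fin 3) ≃ᵃⁱ[ℝ] EuclideanSpace ℝ (Fin 3)),
                0 < a ∧ IsHaggSeq s ∧
                |c - a * Real.sqrt (2 / 3)| ≤ a * Real.sqrt (2 / 3) / 250 ∧
                (∀ j k : Fin N, j ≠ k → dist (y j) (y i) ≤ 3 * a → a / 2 ≤ dist (y j) (y k)) ∧
                (∀ j : Fin N, dist (y j) (y i) ≤ 3 * a →
                    ∃ z ∈ barlowStacking a c s, dist (y j) (g z) ≤ ρ * a) ∧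
                (∀ z ∈ barlowStacking a c s, dist (g z) (y i) ≤ 3 * a →
                    ∃ j : Fin N, dist (y j) (g z) ≤ ρ * a)} : ℝ)
          ≤ interactionEnergy (fun r => min 1 (max 0 (4 - 2 * r)) * lennardJones r) y) →
    (∃ κ' : ℝ, 0 < κ' ∧
      ∀ (N : ℕ) (y : Fin N → EuclideanSpace ℝ (Fin 3)), Function.Injective y →
        (N : ℝ) * (⨅ Q : PeriodicConfiguration 3,
            Q.energyPerParticle fun r => min 1 (max 0 (4 - 2 * r)) * lennardJones r)
          + κ' * (Nat.card {i : Fin N //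
              ¬ ∃ (a c : ℝ) (s : ℤ → ℤ)
                  (g : EuclideanSpace ℝ (Fin 3) ≃ᵃⁱ[ℝ] EuclideanSpace ℝ (Fin 3)),
                0 < a ∧ IsHaggSeq s ∧
                |c - a * Real.sqrt (2 / 3)| ≤ a * Real.sqrt (2 / 3) / 250 ∧
                (∀ j k : Fin N, j ≠ k → dist (y j) (y i) ≤ 3 * a → a / 2 ≤ dist (y j) (y k)) ∧
                (∀ j : Fin N, dist (y j) (y i) ≤ 3 * a →
                    ∃ z ∈ barlowStacking a c s, dist (y j) (g z) ≤ ρ * a) ∧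
                (∀ z ∈ barlowStacking a c s, dist (g z) (y i) ≤ 3 * a →
                    ∃ j : Fin N, dist (y j) (g z) ≤ ρ * a)} : ℝ)
          ≤ interactionEnergy (fun r => min 1 (max 0 (4 - 2 * r)) * lennardJones r) y) →
    Summit.AtomisticToContinuum.Crystallization.Theses.PricedLinkCensus.TruncatedCensusGap := by
  rintro ρ ⟨Q₀, κ, C, hκ, hC, hnear⟩ ⟨κ', hκ', hfar⟩
  have hden : 0 < κ' + C := by linarith
  refine truncatedCensusGap_of_metricDefectGap ⟨κ * κ' / (κ' + C), by positivity, fun N y hy => ?_⟩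
  set eS : ℝ := ⨅ Q : PeriodicConfiguration 3,
    Q.energyPerParticle fun r => min 1 (max 0 (4 - 2 * r)) * lennardJones r with heS
  set E : ℝ := interactionEnergy (fun r => min 1 (max 0 (4 - 2 * r)) * lennardJones r) y with hE
  set F : ℝ := (Nat.card {i : Fin N //
              ¬ ∃ (a c : ℝ) (s : ℤ → ℤ)
                  (g : EuclideanSpace ℝ (Fin 3) ≃ᵃⁱ[ℝ] EuclideanSpace ℝ (Fin 3)),
                0 < a ∧ IsHaggSeq s ∧
                |c - a * Real.sqrt (2 / 3)| ≤ a * Real.sqrt (2 / 3) / 250 ∧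
                (∀ j k : Fin N, j ≠ k → dist (y j) (y i) ≤ 3 * a → a / 2 ≤ dist (y j) (y k)) ∧
                (∀ j : Fin N, dist (y j) (y i) ≤ 3 * a →
                    ∃ z ∈ barlowStacking a c s, dist (y j) (g z) ≤ 1 / 1000 * a) ∧
                (∀ z ∈ barlowStacking a c s, dist (g z) (y i) ≤ 3 * a →
                    ∃ j : Fin N, dist (y j) (g z) ≤ 1 / 1000 * a)} : ℝ) with hF
  set G : ℝ := (Nat.card {i : Fin N //
              ¬ ∃ (a c : ℝ) (s : ℤ → ℤ)
                  (g : EuclideanSpace ℝ (Fin 3) ≃ᵃⁱ[ℝ] EuclideanSpace ℝ (Fin 3)),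
                0 < a ∧ IsHaggSeq s ∧
                |c - a * Real.sqrt (2 / 3)| ≤ a * Real.sqrt (2 / 3) / 250 ∧
                (∀ j k : Fin N, j ≠ k → dist (y j) (y i) ≤ 3 * a → a / 2 ≤ dist (y j) (y k)) ∧
                (∀ j : Fin N, dist (y j) (y i) ≤ 3 * a →
                    ∃ z ∈ barlowStacking a c s, dist (y j) (g z) ≤ ρ * a) ∧
                (∀ z ∈ barlowStacking a c s, dist (g z) (y i) ≤ 3 * a →
                    ∃ j : Fin N, dist (y j) (g z) ≤ ρ * a)} : ℝ) with hG
  have h1 : (N : ℝ) * Q₀.energyPerParticle (fun r => min 1 (max 0 (4 - 2 * r)) * lennardJones r)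
      + κ * F - C * G ≤ E := hnear N y hy
  have h2 : (N : ℝ) * eS + κ' * G ≤ E := hfar N y hy
  have hle : eS ≤ Q₀.energyPerParticle (fun r => min 1 (max 0 (4 - 2 * r)) * lennardJones r) :=
    ciInf_le stub_periodicStability Q₀
  have hle' := mul_le_mul_of_nonneg_left hle (Nat.cast_nonneg N)
  -- `κ F ≤ (E − N e*) + C G` and `κ' G ≤ E − N e*`
  have h3 : κ * F ≤ (E - (N : ℝ) * eS) + C * G := by linarith
  have h4 : κ' * G ≤ E - (N : ℝ) * eS := by linarith
  have h5 : C * (κ' * G) ≤ C * (E - (N : ℝ) * eS) := mul_le_mul_of_nonneg_left h4 hC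
  -- multiply `h3` by `κ' > 0` and combine
  have h6 : κ' * (κ * F) ≤ κ' * (E - (N : ℝ) * eS) + κ' * (C * G) :=
    by nlinarith [h3, hκ'.le]
  have h7 : κ' * (κ * F) ≤ (κ' + C) * (E - (N : ℝ) * eS) := by nlinarith [h5, h6]
  have h8 : κ * κ' / (κ' + C) * F ≤ E - (N : ℝ) * eS := by
    rw [div_mul_eq_mul_div, div_le_iff₀ hden]
    nlinarith [h7]
  linarith

end Summit.AtomisticToContinuum.Crystallization.Theorems.PricedLinkCensusTruncatedCensusGap

end
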